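import Literature.Combinatorics.SetFamily.BiasedMeasure
import Mathlib.Analysis.SpecialFunctions.Log.Basic
import HarnessLib

/-!
# Spread families, minimum fragments, and the statement of the spread lemma

The **spread lemma** (Alweiss–Lovett–Wu–Zhang 2020; Rao 2020, Lemma 4; Tao 2020;
Bell–Chueluecha–Warnke 2021, Thm. 3; in the form of Bell 2023, Thm. 3 + Lemma 10) is the
probabilistic core of the improved sunflower bounds and of the robust-sunflower bound used by
Cavalar–Kumar–Rossman (Algorithmica 2022, Thm. 6.1): if a nonempty family `F` of sets of size
`≤ ℓ` is `r`-spread with `r = B log(ℓ/ε) / p`, then a `p`-random subset of the ground set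
contains a member of `F` with probability `> 1 - ε`.

This file sets up the combinatorics of the Park–Pham "minimum fragment" argument
(Park–Pham 2024, §2; Bell 2023, §2–3); the lemma itself is PROVED in `SpreadLemmaProofs.lean`
(`spread_lemma`, via the halving process of `SpreadLemmaProcess.lean`):

* `IsSpread r F` — every set `Z` is contained in at most `|F| / r^{|Z|}` members of `F`
  (relative spreadness, Talagrand 2010 / Tao 2020 / CKR 2022, §6);
* `one_le_sum_inv_pow_of_cover` — a spread family is not `1/r`-small: every family `G`
  undercovering `F` has `∑_{T ∈ G} r^{-|T|} ≥ 1` (Bell 2023, Lemma 10; Talagrand 2010, Prop. 6.7);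
* `frag H W S` — a minimum `(S, W)`-fragment `T(S, W) = S' \ W`, `S' ∈ H`, `S' ⊆ W ∪ S`, of least
  size (Park–Pham 2024, §2); `pick H Z` — a fixed choice of a member of `H` inside `Z`;
  `frag_subset_pick` — the key observation `T(S, W) ⊆ pick(W ∪ T(S, W))`;
* `sum_biasedWeight_mul_card_fragsOfCard_le` — **Park–Pham's counting lemma** in `p`-biased
  form (Park–Pham 2024, Lemma 2.1; Bell 2023, Prop. 4): for an `ℓ`-bounded `H` and `W ∼ μ_q`,
  `E_W #{T(S, W) : S ∈ H, |T(S, W)| = t} ≤ (ℓ choose t) / q^t`.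

## References

* T. Bell, *The Park–Pham theorem with optimal convergence rate*, Electron. J. Combin. 30(2)
  (2023) P2.25, Thm. 3, Prop. 4, Lemma 10 [Bell2023].
* J. Park, H. T. Pham, *A proof of the Kahn–Kalai conjecture*, J. Amer. Math. Soc. 37 (2024),
  Lemma 2.1 [ParkPham2024].
* A. Rao, *Coding for sunflowers*, Discrete Anal. 2020:2, Lemma 4 [Rao2020].
* T. Bell, S. Chueluecha, L. Warnke, *Note on sunflowers*, Discrete Math. 344 (2021), Thm. 3
  [BellChueluechaWarnke2021].
* B. P. Cavalar, M. Kumar, B. Rossman, *Monotone circuit lower bounds from robust sunflowers*,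
  Algorithmica 84 (2022), Thm. 6.1 [CavalarKumarRossman2022].
-/

namespace Literature.Combinatorics.SetFamily

open Finset

variable {α : Type*} [DecidableEq α]

/-! ### Spread families -/

/-- A family `F` is `r`-*spread* if for every set `Z` at most `|F| / r^{|Z|}` members of `F`
contain `Z` (CKR 2022, §6; Tao 2020; Bell 2023, Def. 8 — the *relative* notion; for `|F| ≥ r^ℓ`
it is implied by the absolute notion `≤ r^{ℓ - |Z|}` of Rao 2020 / BCW 2021).
[cite: CavalarKumarRossman2022, §6] -/
def IsSpread (r : ℝ) (F : Finset (Finset α)) : Prop :=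
  ∀ Z : Finset α, (#(F.filter fun S => Z ⊆ S) : ℝ) ≤ #F / r ^ #Z

/-- **A spread family is not `r⁻¹`-small** (Bell 2023, Lemma 10; Talagrand 2010, Prop. 6.2/6.7):
if every member of a nonempty `r`-spread family `F` contains a member of `G`, then
`∑_{T ∈ G} r^{-|T|} ≥ 1`. [cite: Bell2023, Lemma 10] -/
theorem one_le_sum_inv_pow_of_cover {r : ℝ} {F : Finset (Finset α)}
    (hF : F.Nonempty) (hsp : IsSpread r F) (G : Finset (Finset α))
    (hcov : ∀ S ∈ F, ∃ T ∈ G, T ⊆ S) : 1 ≤ ∑ T ∈ G, (1 / r) ^ #T := by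
  have hFpos : (0 : ℝ) < #F := by exact_mod_cast hF.card_pos
  have h1 : (#F : ℝ) ≤ ∑ T ∈ G, (#(F.filter fun S => T ⊆ S) : ℝ) := by
    have hsub : F ⊆ G.biUnion fun T => F.filter fun S => T ⊆ S := by
      intro S hS
      obtain ⟨T, hT, hTS⟩ := hcov S hS
      exact mem_biUnion.2 ⟨T, hT, mem_filter.2 ⟨hS, hTS⟩⟩
    calc (#F : ℝ) ≤ #(G.biUnion fun T => F.filter fun S => T ⊆ S) := by
          exact_mod_cast card_le_card hsub
      _ ≤ ∑ T ∈ G, (#(F.filter fun S => T ⊆ S) : ℝ) := by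
          exact_mod_cast card_biUnion_le
  have h2 : ∑ T ∈ G, (#(F.filter fun S => T ⊆ S) : ℝ) ≤ ∑ T ∈ G, #F * (1 / r) ^ #T := by
    refine sum_le_sum fun T _ => ?_
    rw [one_div, inv_pow, ← div_eq_mul_inv]
    exact hsp T
  rw [← mul_sum] at h2
  have h3 : (#F : ℝ) * 1 ≤ #F * ∑ T ∈ G, (1 / r) ^ #T := by rw [mul_one]; exact h1.trans h2
  exact le_of_mul_le_mul_left h3 hFpos

/-! ### Minimum fragments (Park–Pham) -/

/-- The `(S, W)`-fragments in `H`: the sets `S' \ W` with `S' ∈ H`, `S' ⊆ W ∪ S`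
(Park–Pham 2024, §2). [cite: ParkPham2024, §2] -/
def fragments (H : Finset (Finset α)) (W S : Finset α) : Finset (Finset α) :=
  (H.filter fun S' => S' ⊆ W ∪ S).image fun S' => S' \ W

/-- `S \ W` is an `(S, W)`-fragment for `S ∈ H`. [cite: ParkPham2024, §2] -/
theorem sdiff_mem_fragments {H : Finset (Finset α)} {W S : Finset α} (hS : S ∈ H) :
    S \ W ∈ fragments H W S :=
  mem_image.2 ⟨S, mem_filter.2 ⟨hS, subset_union_right⟩, rfl⟩

/-- A *minimum fragment* `T(S, W)`: an `(S, W)`-fragment of least cardinality (ties broken by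
choice; `∅` if there is none, which does not happen for `S ∈ H`) (Park–Pham 2024, §2;
Bell 2023, §2). [cite: ParkPham2024, §2] -/
noncomputable def frag (H : Finset (Finset α)) (W S : Finset α) : Finset α :=
  if h : (fragments H W S).Nonempty then
    Classical.choose (exists_min_image (fragments H W S) card h) else ∅

/-- The defining property of the minimum fragment. [cite: ParkPham2024, §2] -/
theorem frag_mem_and_le {H : Finset (Finset α)} {W S : Finset α} (hS : S ∈ H) :
    frag H W S ∈ fragments H W S ∧ ∀ T ∈ fragments H W S, #(frag H W S) ≤ #T := by
  have h : (fragments H W S).Nonempty := ⟨_, sdiff_mem_fragments hS⟩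
  rw [frag, dif_pos h]
  exact Classical.choose_spec (exists_min_image (fragments H W S) card h)

/-- A minimum fragment is `S' \ W` for some `S' ∈ H` with `S' ⊆ W ∪ S`. [cite: ParkPham2024, §2] -/
theorem exists_eq_frag {H : Finset (Finset α)} {W S : Finset α} (hS : S ∈ H) :
    ∃ S' ∈ H, S' ⊆ W ∪ S ∧ frag H W S = S' \ W := by
  obtain ⟨S', hS', heq⟩ := mem_image.1 (frag_mem_and_le hS).1
  exact ⟨S', (mem_filter.1 hS').1, (mem_filter.1 hS').2, heq.symm⟩

/-- Minimality of the minimum fragment. [cite: ParkPham2024, §2] -/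
theorem card_frag_le {H : Finset (Finset α)} {W S S' : Finset α} (hS : S ∈ H) (hS' : S' ∈ H)
    (hsub : S' ⊆ W ∪ S) : #(frag H W S) ≤ #(S' \ W) :=
  (frag_mem_and_le hS).2 _ (mem_image.2 ⟨S', mem_filter.2 ⟨hS', hsub⟩, rfl⟩)

/-- A minimum fragment of `S` lies inside `S`. [cite: ParkPham2024, §2] -/
theorem frag_subset {H : Finset (Finset α)} {W S : Finset α} (hS : S ∈ H) : frag H W S ⊆ S := by
  obtain ⟨S', -, hsub, heq⟩ := exists_eq_frag hS
  rw [heq]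
  intro x hx
  rw [mem_sdiff] at hx
  rcases mem_union.1 (hsub hx.1) with h | h
  · exact absurd h hx.2
  · exact h

/-- A minimum fragment is disjoint from `W`. [cite: ParkPham2024, §2] -/
theorem disjoint_frag {H : Finset (Finset α)} {W S : Finset α} (hS : S ∈ H) :
    Disjoint (frag H W S) W := by
  obtain ⟨S', -, -, heq⟩ := exists_eq_frag hS
  rw [heq]
  exact sdiff_disjoint

/-- Minimum fragments have size at most the bound of the family. [cite: ParkPham2024, §2] -/
theorem card_frag_le_of_bounded {H : Finset (Finset α)} {l : ℕ} (hH : ∀ S ∈ H, #S ≤ l)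
    {W S : Finset α} (hS : S ∈ H) : #(frag H W S) ≤ l :=
  (card_le_card (frag_subset hS)).trans (hH S hS)

/-- A fixed choice ("tie-breaker", Bell 2023, proof of Prop. 4) of a member of `H` contained in
`Z`, or `∅` if there is none. [cite: Bell2023, Prop. 4] -/
noncomputable def pick (H : Finset (Finset α)) (Z : Finset α) : Finset α :=
  if h : ∃ S ∈ H, S ⊆ Z then Classical.choose h else ∅

/-- The tie-breaker picks a member of `H` inside `Z` when there is one. [cite: Bell2023, Prop. 4] -/
theorem pick_mem_and_subset {H : Finset (Finset α)} {Z : Finset α} (h : ∃ S ∈ H, S ⊆ Z) :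
    pick H Z ∈ H ∧ pick H Z ⊆ Z := by
  rw [pick, dif_pos h]
  obtain ⟨h1, h2⟩ := Classical.choose_spec h
  exact ⟨h1, h2⟩

/-- The tie-breaker of an `l`-bounded family has size `≤ l`. [cite: Bell2023, Prop. 4] -/
theorem card_pick_le {H : Finset (Finset α)} {l : ℕ} (hH : ∀ S ∈ H, #S ≤ l) (Z : Finset α) :
    #(pick H Z) ≤ l := by
  by_cases h : ∃ S ∈ H, S ⊆ Z
  · exact hH _ (pick_mem_and_subset h).1
  · rw [pick, dif_neg h]
    simp

/-- **Key observation** (Park–Pham 2024, (2.3); Bell 2023, proof of Prop. 4): the minimum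
fragment `T = T(S, W)` is contained in the tie-breaker of `Z = W ∪ T`, since the latter is an
`(S, W)`-candidate lying inside `W ∪ T`. [cite: ParkPham2024, Lemma 2.1] -/
theorem frag_subset_pick {H : Finset (Finset α)} {W S : Finset α} (hS : S ∈ H) :
    frag H W S ⊆ pick H (W ∪ frag H W S) := by
  obtain ⟨S', hS', hsub, heq⟩ := exists_eq_frag hS
  set T := frag H W S with hT
  have hex : ∃ S'' ∈ H, S'' ⊆ W ∪ T := ⟨S', hS', by
    rw [heq, union_sdiff_self_eq_union]; exact subset_union_right⟩
  obtain ⟨hP, hPZ⟩ := pick_mem_and_subset hex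
  set P := pick H (W ∪ T)
  have hPWS : P ⊆ W ∪ S :=
    hPZ.trans (union_subset_union (Subset.refl W) (frag_subset hS))
  have h1 : #T ≤ #(P \ W) := card_frag_le hS hP hPWS
  have h2 : P \ W ⊆ T := by
    intro x hx
    rw [mem_sdiff] at hx
    rcases mem_union.1 (hPZ hx.1) with h | h
    · exact absurd h hx.2
    · exact h
  have h3 : P \ W = T := eq_of_subset_of_card_le h2 h1
  rw [← h3]
  exact sdiff_subset

/-! ### Park–Pham's counting lemma, `p`-biased form -/

/-- The minimum fragments of size exactly `t` produced by `W` (Bell 2023, `𝒰_t(H, W)`).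
[cite: Bell2023, Prop. 4] -/
noncomputable def fragsOfCard (H : Finset (Finset α)) (W : Finset α) (t : ℕ) : Finset (Finset α) :=
  (H.image (frag H W)).filter fun T => #T = t

variable [Fintype α]

/-- **Park–Pham's counting lemma** in `p`-biased form (Park–Pham 2024, Lemma 2.1; Bell 2023,
Prop. 4, there for uniform `W` of fixed size): for an `l`-bounded family `H` and `W ∼ μ_q`,
`E_W #{T(S, W) : S ∈ H, |T(S, W)| = t} ≤ (l choose t) / q^t`. Proof: the specification
`(W, T) ↦ (Z = W ⊔ T, T ⊆ pick(Z))` is injective, `μ_q(W) = μ_q(Z) ((1-q)/q)^t`, and there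
are at most `(l choose t)` subsets `T` of `pick(Z)`. [cite: Bell2023, Prop. 4] -/
theorem sum_biasedWeight_mul_card_fragsOfCard_le (H : Finset (Finset α)) {l : ℕ}
    (hH : ∀ S ∈ H, #S ≤ l) (t : ℕ) {q : ℝ} (hq0 : 0 < q) (hq1 : q ≤ 1) :
    ∑ W : Finset α, biasedWeight q W * #(fragsOfCard H W t) ≤ (l.choose t : ℝ) / q ^ t := by
  set ρ : ℝ := ((1 - q) / q) ^ t with hρ
  have hρ0 : 0 ≤ ρ := pow_nonneg (div_nonneg (by linarith) hq0.le) t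
  -- the pairs `(W, T)`
  set P : Finset (Finset α × Finset α) :=
    (univ ×ˢ univ).filter fun y => y.2 ∈ fragsOfCard H y.1 t with hP
  have hLHS : ∑ W : Finset α, biasedWeight q W * #(fragsOfCard H W t)
      = ∑ y ∈ P, biasedWeight q y.1 := by
    rw [hP, sum_filter, sum_product]
    refine sum_congr rfl fun W _ => ?_
    show biasedWeight q W * _ = ∑ a, if a ∈ fragsOfCard H W t then biasedWeight q W else 0
    rw [← sum_filter, filter_mem_eq_inter, univ_inter, sum_const, nsmul_eq_mul, mul_comm]
  -- facts about members of `P`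
  have hmemP : ∀ y ∈ P, ∃ S ∈ H, y.2 = frag H y.1 S ∧ #y.2 = t := by
    intro y hy
    obtain ⟨hy1, hy2⟩ := mem_filter.1 (mem_filter.1 hy).2
    obtain ⟨S, hS, hSe⟩ := mem_image.1 hy1
    exact ⟨S, hS, hSe.symm, hy2⟩
  -- the specification map
  set e : Finset α × Finset α → Finset α × Finset α := fun y => (y.1 ∪ y.2, y.2) with he
  have hinj : Set.InjOn e ↑P := by
    intro y hy y' hy' hyy'
    obtain ⟨S, hS, hyS, -⟩ := hmemP y hy
    obtain ⟨S', hS', hyS', -⟩ := hmemP y' hy'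
    simp only [he, Prod.mk.injEq] at hyy'
    obtain ⟨hU, h2⟩ := hyy'
    have hd : Disjoint y.1 y.2 := by rw [hyS]; exact (disjoint_frag hS).symm
    have hd' : Disjoint y'.1 y'.2 := by rw [hyS']; exact (disjoint_frag hS').symm
    have h1 : y.1 = y'.1 := by
      calc y.1 = (y.1 ∪ y.2) \ y.2 := (union_sdiff_cancel_right hd).symm
        _ = (y'.1 ∪ y'.2) \ y'.2 := by rw [hU, h2]
        _ = y'.1 := union_sdiff_cancel_right hd'
    exact Prod.ext h1 h2
  -- the weight transported along `e`
  set ν : Finset α × Finset α → ℝ := fun z => biasedWeight q z.1 * ρ with hν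
  have hν0 : ∀ z, 0 ≤ ν z := fun z => mul_nonneg (biasedWeight_nonneg hq0.le hq1 _) hρ0
  have hweight : ∀ y ∈ P, biasedWeight q y.1 = ν (e y) := by
    intro y hy
    obtain ⟨S, hS, hyS, hyt⟩ := hmemP y hy
    have hd : Disjoint y.1 y.2 := by rw [hyS]; exact (disjoint_frag hS).symm
    simp only [hν, he, biasedWeight, hρ]
    rw [card_union_of_disjoint hd, hyt]
    have hle : #y.1 + t ≤ Fintype.card α := by
      rw [← hyt, ← card_union_of_disjoint hd]; exact card_le_univ _
    obtain ⟨m, hm⟩ : ∃ m, Fintype.card α = #y.1 + t + m := ⟨_, (Nat.add_sub_cancel' hle).symm⟩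
    rw [hm, show #y.1 + t + m - (#y.1 + t) = m by omega, show #y.1 + t + m - #y.1 = t + m by omega,
      pow_add, pow_add, div_pow]
    have hqt : q ^ t ≠ 0 := pow_ne_zero _ hq0.ne'
    field_simp
  -- the target set of the specification
  set Q : Finset (Finset α × Finset α) :=
    (univ ×ˢ univ).filter fun z => z.2 ⊆ pick H z.1 ∧ #z.2 = t with hQ
  have himage : P.image e ⊆ Q := by
    intro z hz
    obtain ⟨y, hy, rfl⟩ := mem_image.1 hz
    obtain ⟨S, hS, hyS, hyt⟩ := hmemP y hy
    refine mem_filter.2 ⟨mem_product.2 ⟨mem_univ _, mem_univ _⟩, ?_, hyt⟩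
    change y.2 ⊆ pick H (y.1 ∪ y.2)
    rw [hyS]
    exact frag_subset_pick hS
  have hsumQ : ∑ z ∈ Q, ν z ≤ (l.choose t : ℝ) * ρ := by
    rw [hQ, sum_filter, sum_product]
    have hinner : ∀ Z : Finset α,
        ∑ T : Finset α, (if T ⊆ pick H Z ∧ #T = t then ν (Z, T) else 0)
          = biasedWeight q Z * ρ * ((#(pick H Z)).choose t : ℝ) := by
      intro Z
      rw [← sum_filter]
      have hset : (univ.filter fun T : Finset α => T ⊆ pick H Z ∧ #T = t)
          = powersetCard t (pick H Z) := by
        ext T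
        simp [mem_powersetCard]
      rw [hset]
      show ∑ a ∈ powersetCard t (pick H Z), biasedWeight q Z * ρ = _
      rw [sum_const, card_powersetCard, nsmul_eq_mul, mul_comm]
    simp_rw [hinner]
    calc ∑ Z : Finset α, biasedWeight q Z * ρ * ((#(pick H Z)).choose t : ℝ)
        ≤ ∑ Z : Finset α, biasedWeight q Z * ρ * (l.choose t : ℝ) := by
          refine sum_le_sum fun Z _ => ?_
          refine mul_le_mul_of_nonneg_left ?_ (mul_nonneg (biasedWeight_nonneg hq0.le hq1 _) hρ0)
          exact_mod_cast Nat.choose_le_choose t (card_pick_le hH Z)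
      _ = (l.choose t : ℝ) * ρ := by
          rw [← sum_mul, ← sum_mul, sum_biasedWeight, one_mul, mul_comm]
  -- assemble
  calc ∑ W : Finset α, biasedWeight q W * #(fragsOfCard H W t)
      = ∑ y ∈ P, ν (e y) := by rw [hLHS]; exact sum_congr rfl hweight
    _ = ∑ z ∈ P.image e, ν z := (sum_image hinj).symm
    _ ≤ ∑ z ∈ Q, ν z := sum_le_sum_of_subset_of_nonneg himage fun z _ _ => hν0 z
    _ ≤ (l.choose t : ℝ) * ρ := hsumQ
    _ ≤ (l.choose t : ℝ) / q ^ t := by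
        rw [hρ, div_pow, ← mul_div_assoc]
        refine div_le_div_of_nonneg_right ?_ (pow_pos hq0 t).le
        refine mul_le_of_le_one_right (Nat.cast_nonneg _) ?_
        exact pow_le_one₀ (by linarith) (by linarith)

end Literature.Combinatorics.SetFamily
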